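import Summits.CriticalPhenomena.PercolationContinuityZ3.Theorems.PercNearOneGluingNoHeavyLowerTailLinearInclusiveCex
import HarnessLib

/-!
# QUANT lane R1: the `|A|`-threshold linear lower tail does NOT hold with constant `1` (the lane's conjecture LNT♯ refuted)

Support file (`--supports stmt-CriticalPhenomena-4575`, computational: rational facts by `native_decide`), seat `prim-quant-p1`;
builds on p205010 (kernel theorem, internal audit signed; external expert review pending).  No definitions, no named facts, no sorries.

The kernel theorem `QuantGluing.linearLowerTail_two` (p207122) says: on every finite weighted graph, if `μ(a ↮ a') ≤ s` for all
`a, a' ∈ A`, then `μ(1 ≤ N ∧ 2N < |A|) ≤ 2·s·μ(o ↔ A)`, `N = #{a ∈ A : o ↔ a}`.  The lane's census seat conjectured (README V19, "LNT♯")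
that the constant `2` can be replaced by `1`.  It cannot: on SIX vertices — observer `o = 0` glued to the relay `1` (weight `1`), relays
`A = {1, 2, 3, 4, 5}` pairwise joined by edges of weight `1/20` — one has `μ(o ↔ A) = 1`, `μ(a ↮ a') = 4824193716417/5120000000000 ≈ 0.94223`
for all `a ≠ a'` in `A`, and `μ(1 ≤ N ∧ 2N < 5) = μ(N ≤ 2) = 307687881/320000000 ≈ 0.96152`: ratio `1.02048 > 1`.  Mechanism: in the sparse
regime `max_{a,a'} μ(a ↮ a') = 1 − Θ(ε)` while `μ(N ≥ 3 ∣ o ↔ A) = Θ(ε²)`.  (Seat census, two independent exact engines; family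
`(k relays, weight ε)`: ratio `1.0317` at `k = 7, ε = 1/30`.)

* `QuantGluing.linearLowerTail_const_one_false` — `¬ ∀ n w A o s, o ∉ A → 0 ≤ s → (∀ a a' ∈ A, μ(a ↮ a') ≤ s) → μ(1 ≤ N ∧ 2N < |A|) ≤ s·μ(o ↔ A)`.
Scope: refutes ONLY the `|A|`-threshold form at constant `1`; the `EN/2`-threshold form `Quant.QuantLowerTailGluing 1` is NOT refuted by this
witness (`EN = 1.23 < 2` there, its event is empty) and remains open between the kernel bounds `[1, 2]` (p207551, p207336).
Method: `CertWeighted`/`…LinearInclusiveCex` machinery (`wNotConn`, `linIncCex_le_real_lowCount`; for `|A| = 5`, `2N ≤ |A| ↔ 2N < |A|`).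
[cite: KozmaNitzan2024, Conjecture 3 (p. 15) and Conj. 1 (p. 3)]
-/

namespace Summit.CriticalPhenomena.PercolationContinuityZ3.Theorems

open MeasureTheory
open Literature.Probability.LatticeModels Literature.Probability.Percolation
open Summit.CriticalPhenomena.PercolationContinuityZ3.Theorems.AdditiveGluing.Negative.Cert

namespace QuantGluing

/-- The six-vertex witness: `{0,1}` of weight `1` and the ten pairs of `{1,…,5}` of weight `1/20`. [folklore] -/
theorem constOne_wlist_nodup :
    (wPairs ([((0 : Fin 6), (1 : Fin 6), (1 : ℚ)), (1, 2, 1/20), (1, 3, 1/20), (1, 4, 1/20), (1, 5, 1/20), (2, 3, 1/20),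
      (2, 4, 1/20), (2, 5, 1/20), (3, 4, 1/20), (3, 5, 1/20), (4, 5, 1/20)] : List (Fin 6 × Fin 6 × ℚ))).Nodup := by
  decide

/-- The witness weights lie in `[0, 1]`. [folklore] -/
theorem constOne_wlist_unit :
    ∀ e ∈ ([((0 : Fin 6), (1 : Fin 6), (1 : ℚ)), (1, 2, 1/20), (1, 3, 1/20), (1, 4, 1/20), (1, 5, 1/20), (2, 3, 1/20),
      (2, 4, 1/20), (2, 5, 1/20), (3, 4, 1/20), (3, 5, 1/20), (4, 5, 1/20)] : List (Fin 6 × Fin 6 × ℚ)), 0 ≤ e.2.2 ∧ e.2.2 ≤ 1 := by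
  intro e he
  simp only [List.mem_cons, List.mem_nil_iff, or_false] at he
  rcases he with rfl | rfl | rfl | rfl | rfl | rfl | rfl | rfl | rfl | rfl | rfl <;> norm_num

open Classical in
/-- **The `|A|`-threshold linear lower tail fails with constant `1`** (the lane's conjecture LNT♯ refuted): it is NOT true that on every
finite weighted graph `μ(1 ≤ N ∧ 2N < |A|) ≤ s·μ(o ↔ A)` whenever `o ∉ A`, `0 ≤ s` and `μ(a ↮ a') ≤ s` on `A × A` — witness: `o` glued to one
of five relays that form a `K₅` of weight-`1/20` edges, `s = 4824193716417/5120000000000 < 307687881/320000000 = μ(N ≤ 2)`, `μ(o ↔ A) = 1`.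
The constant `2` (`linearLowerTail_two`) is therefore not improvable to `1` in this form. [cite: KozmaNitzan2024, Conjecture 3 (p. 15)] -/
theorem linearLowerTail_const_one_false :
    ¬ ∀ (n : ℕ) (w : Sym2 (Fin n) → unitInterval) (A : Finset (Fin n)) (o : Fin n) (s : ℝ), o ∉ A → 0 ≤ s →
      (∀ a ∈ A, ∀ a' ∈ A, (prodBernoulli w).real (openConn a a')ᶜ ≤ s) →
      (prodBernoulli w).real {ω | 1 ≤ (A.filter fun a => ω ∈ openConn o a).card ∧
          2 * (A.filter fun a => ω ∈ openConn o a).card < A.card} ≤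
        s * (prodBernoulli w).real (⋃ a ∈ A, openConn o a) := by
  intro h
  set l : List (Fin 6 × Fin 6 × ℚ) := [((0 : Fin 6), (1 : Fin 6), (1 : ℚ)), (1, 2, 1/20), (1, 3, 1/20), (1, 4, 1/20),
    (1, 5, 1/20), (2, 3, 1/20), (2, 4, 1/20), (2, 5, 1/20), (3, 4, 1/20), (3, 5, 1/20), (4, 5, 1/20)] with hl
  have hnd : (wPairs l).Nodup := constOne_wlist_nodup
  have hq : ∀ e ∈ l, 0 ≤ e.2.2 ∧ e.2.2 ≤ 1 := constOne_wlist_unit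
  set A : Finset (Fin 6) := {1, 2, 3, 4, 5} with hA
  set μ := prodBernoulli (wOfList l) with hμ
  set s : ℚ := 4824193716417 / 5120000000000 with hsdef
  -- the hypotheses of the instance
  have hs : ∀ a ∈ A, ∀ a' ∈ A, μ.real (openConn a a')ᶜ ≤ ((s : ℚ) : ℝ) := by
    intro a ha a' ha'
    rw [hμ, real_compl_openConn_eq_wNotConn hnd hq a a']
    have key : ∀ a ∈ A, ∀ a' ∈ A, wNotConn (wtabs 6 l) a a' ≤ s := by native_decide
    exact (Rat.cast_le (K := ℝ)).2 (key a ha a' ha')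
  have hs0 : (0 : ℝ) ≤ ((s : ℚ) : ℝ) := by
    have : (0 : ℚ) ≤ s := by rw [hsdef]; norm_num
    exact_mod_cast this
  have hinst := h 6 (wOfList l) A 0 ((s : ℚ) : ℝ) (by decide) hs0 hs
  rw [← hμ] at hinst
  -- the low-count event has probability ≥ 307687881/320000000
  have hlow : ((307687881 / 320000000 : ℚ) : ℝ) ≤ μ.real {ω | 1 ≤ (A.filter fun x => ω ∈ openConn (0 : Fin 6) x).card ∧
      2 * (A.filter fun x => ω ∈ openConn (0 : Fin 6) x).card ≤ A.card} := by
    rw [hμ]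
    refine linIncCex_le_real_lowCount hnd hq 0 A ?_
    native_decide
  have hcard : A.card = 5 := by rw [hA]; decide
  -- for `|A| = 5`, `2N ≤ 5 ↔ 2N < 5`
  have hsub : {ω | 1 ≤ (A.filter fun x => ω ∈ openConn (0 : Fin 6) x).card ∧
        2 * (A.filter fun x => ω ∈ openConn (0 : Fin 6) x).card ≤ A.card} ⊆
      {ω | 1 ≤ (A.filter fun a => ω ∈ openConn (0 : Fin 6) a).card ∧
        2 * (A.filter fun a => ω ∈ openConn (0 : Fin 6) a).card < A.card} := by
    intro ω hω
    obtain ⟨h1, h2⟩ := hω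
    refine ⟨h1, ?_⟩
    rw [hcard] at h2 ⊢
    omega
  have hE := (measureReal_mono hsub (measure_ne_top μ _)).trans' hlow
  -- `μ(o ↔ A) ≤ 1`
  have hU : μ.real (⋃ a ∈ A, openConn (0 : Fin 6) a) ≤ 1 := measureReal_le_one
  -- the two rationals compare the wrong way for `h`
  have hlt : ((s : ℚ) : ℝ) < ((307687881 / 320000000 : ℚ) : ℝ) := by
    have : s < 307687881 / 320000000 := by rw [hsdef]; norm_num
    exact_mod_cast this
  have hsu : ((s : ℚ) : ℝ) * μ.real (⋃ a ∈ A, openConn (0 : Fin 6) a) ≤ ((s : ℚ) : ℝ) :=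
    mul_le_of_le_one_right hs0 hU
  have hchain := hE.trans (hinst.trans hsu)
  exact absurd hchain (not_le.2 hlt)

end QuantGluing

end Summit.CriticalPhenomena.PercolationContinuityZ3.Theorems
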